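import Literature.Analysis.FluidPDE.GigaMiura2011ScaledAlignmentBlowupLimitHolds
import Literature.Analysis.FluidPDE.NSCriticalClosureBesovBounded
import Literature.Analysis.FluidPDE.TaoLocalisationHolds
import HarnessLib

/-!
# Route `ExtremiserTransience`, LINE g5-α repair (seat ns-idea-5 g5): KNSS COMPACTNESS OF MOVING-CENTRE ZOOMS into the weak one-slice class

`--supports stmt-NavierStokesRegularity-27822` (`PlateauSliceTransfer`).  This is stub S2 `stub_zoomCompactnessKNSS` of the v3 («tree-matched»)
skeleton for 27822 (evidence `PlateauSliceTransfer_skeleton_v3.lean`; composition `PlateauSliceTransfer_of3 : S1 → S2 → S3 → PlateauSliceTransfer`,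
S3 = `plateauPersistenceSlice`, landed), proved outright and stated with the skeleton's `zoom`/`InWeakAncientClass` UNFOLDED (so that the file is
route-independent):

> zooms `w_n(s,y) = A_n⁻¹ u(τ_n + ν s/A_n², x_n + (ν/A_n) y)` of a classical Leray–Hopf flow from rapidly decaying data, around ARBITRARY centres
> `(x_n, τ_n)`, with `‖u‖ ≤ N·A_n` on `(0, τ_n)`, the zoom Type-I bound `√(−s)‖w_n(s)‖ ≤ K` on their past, and `τ_n A_n²/ν → ∞`, have a subsequence
> converging slice-wise locally uniformly at every `t < 0` to a `W` of the weak one-slice class: jointly continuous on `(−∞,0) × ℝ³`, Oseen-mild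
> between all negative times, Type-I bounded with the same `K`.

It is the tree's KNSS 2009 Lemma 6.1 (`KNSS2009_lemma61_oseenMild`, rate-free, bounded Oseen-mild form) applied to the zooms, which are classical
unit-viscosity solutions on their windows (`zoom_isClassical_window`) satisfying the Oseen identity there (`zoom_oseen_window`, over the slab bounds
`exists_forall_norm_le_of_tao2011`); the Type-I bound passes to the pointwise limit.  HONEST FRAMING: a compactness step about hypothetical flows;
nothing about Navier–Stokes regularity or blow-up is proved here and no summit is proved by a line.
[cite: KochNadirashviliSereginSverak2009, Lemma 6.1 (arXiv p. 11)]
-/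

noncomputable section

open scoped Topology
open Filter Set MeasureTheory Function Metric
open Literature.Analysis Literature.Analysis.FluidPDE

namespace Summit.NavierStokesRegularity.NavierStokesRegularity.Theorems.ExtremiserTransience
set_option linter.dupNamespace false

/-- **KNSS compactness of moving-centre zooms into the weak one-slice class** (stub S2 of the v3 skeleton for 27822, `zoom` and
`InWeakAncientClass` unfolded). [cite: KochNadirashviliSereginSverak2009, Lemma 6.1 (arXiv p. 11)] -/
theorem zoomCompactnessKNSS : ∀ (ν T : ℝ) (u : ℝ → EuclideanSpace ℝ (Fin 3) → EuclideanSpace ℝ (Fin 3)) (p : ℝ → EuclideanSpace ℝ (Fin 3) → ℝ), 0 < ν → 0 < T → Literature.Analysis.FluidPDE.IsClassicalNSSolutionOn (Set.Ico 0 T) ν 0 u p → Literature.Analysis.FluidPDE.IsLerayHopfOn T ν 0 (u 0) u → Literature.Analysis.FluidPDE.HasRapidSpatialDecay (u 0) → ∀ (x : ℕ → EuclideanSpace ℝ (Fin 3)) (τ A : ℕ → ℝ) (N K : ℝ), 0 ≤ N → (∀ n, 0 < τ n ∧ τ n < T ∧ 0 < A n ∧ (∀ t ∈ Set.Ioo 0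 (τ n), ∀ y, ‖u t y‖ ≤ N * A n) ∧ (∀ s : ℝ, -(τ n * A n ^ 2 / ν) < s → s < 0 → ∀ y, Real.sqrt (-s) * ‖(A n)⁻¹ • u (τ n + ν * s / A n ^ 2) (x n + (ν / A n) • y)‖ ≤ K)) → Filter.Tendsto (fun n => τ n * A n ^ 2 / ν) Filter.atTop Filter.atTop → ∃ (W : ℝ → EuclideanSpace ℝ (Fin 3) → EuclideanSpace ℝ (Fin 3)) (φ : ℕ → ℕ), StrictMono φ ∧ (ContinuousOn (Function.uncurry W) (Set.Iio (0 : ℝ) ×ˢ Set.univ) ∧ (∀ s t : ℝ, s < t → t < 0 → ∀ x, W t x = Literature.Analysis.FluidPDE.heatFlow (W s) (t - s) x - Literature.Analysis.FluidPDE.oseenDuhamel 1 s W W t x) ∧ (∀ t : ℝ, t < 0 → ∀ x, Real.sqrt (-t) * ‖W t x‖ ≤ K)) ∧ ∀ t : ℝ, t < 0 → TendstoLocallyUniformly (fun k => fun y => (A (φ k))⁻¹ • u (τ (φ k) + ν * t / A (φ k) ^ 2) (x (φ k) + (ν / A (φ k)) • y)) (W t) Filter.atTop := by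
  intro ν T u p hν hT hsol hLH h₀ x τ A N K hN hn hdivT
  have hν0 : ν ≠ 0 := hν.ne'
  have hA0 : ∀ k, A k ≠ 0 := fun k => (hn k).2.2.1.ne'
  -- slab bounds of the classical Leray–Hopf flow (Tao 2013 localisation, in the tree)
  have hbdd : ∀ T₁ ∈ Ioo 0 T, ∃ M : ℝ, ∀ t ∈ Icc 0 T₁, ∀ y, ‖u t y‖ ≤ M :=
    exists_forall_norm_le_of_tao2011 tao2011_hasBoundedSobolevNormsOn_holds hν hsol hLH h₀
  -- the zooms in `stPull` form: amplitude `λ_k/ν = A_k⁻¹`, space scale `λ_k = ν/A_k`, time scale `λ_k²/ν = ν/A_k²`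
  set lam : ℕ → ℝ := fun k => ν / A k with hlamdef
  have hlam : ∀ k, 0 < lam k := fun k => div_pos hν (hn k).2.2.1
  have hlam1 : ∀ k, lam k / ν = (A k)⁻¹ := fun k => by simp only [hlamdef]; field_simp
  have hlam2 : ∀ k, lam k ^ 2 / ν = ν / A k ^ 2 := fun k => by simp only [hlamdef]; field_simp
  set w : ℕ → ℝ → EuclideanSpace ℝ (Fin 3) → EuclideanSpace ℝ (Fin 3) :=
    fun k => (lam k / ν) • stPull (lam k ^ 2 / ν) (lam k) (τ k) (x k) u with hwdef
  have hZw : ∀ k s y, (A k)⁻¹ • u (τ k + ν * s / A k ^ 2) (x k + (ν / A k) • y) = w k s y := by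
    intro k s y
    show _ = ((lam k / ν) • stPull (lam k ^ 2 / ν) (lam k) (τ k) (x k) u) s y
    rw [smul_stPull_apply, hlam1 k, hlam2 k, show ν / A k ^ 2 * s = ν * s / A k ^ 2 by ring]
  -- the windows `(A'_k, B'_k)` of the zooms
  set Aw : ℕ → ℝ := fun k => -(τ k * ν / lam k ^ 2) with hAwdef
  set Bw : ℕ → ℝ := fun k => (T - τ k) * ν / lam k ^ 2 with hBwdef
  have hAw : ∀ k, Aw k = -(τ k * A k ^ 2 / ν) := fun k => by
    simp only [hAwdef, hlamdef]; field_simp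
  have hBwpos : ∀ k, 0 < Bw k := fun k => by
    simp only [hBwdef]; exact div_pos (mul_pos (sub_pos.2 (hn k).2.1) hν) (pow_pos (hlam k) 2)
  have hAlim : Tendsto Aw atTop atBot := by
    refine (tendsto_neg_atTop_atBot.comp hdivT).congr fun k => ?_
    rw [hAw k]; rfl
  -- the zooms are classical unit-viscosity solutions on their windows, Oseen-mild there, bounded by `N` on the past
  have hwcl : ∀ k, IsClassicalNSSolutionOn (Ioo (Aw k) (Bw k)) 1 0 (w k)
      ((lam k / ν) ^ 2 • stPull (lam k ^ 2 / ν) (lam k) (τ k) (x k) p) := fun k =>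
    zoom_isClassical_window (t₀ := τ k) (x₀ := x k) hν hsol (hlam k)
  have hcont : ∀ k, ContinuousOn (uncurry (w k)) (Ioo (Aw k) 0 ×ˢ univ) := fun k =>
    (hwcl k).smooth_velocity.continuousOn.mono (prod_mono (Ioo_subset_Ioo_right (hBwpos k).le) Subset.rfl)
  have hdivw : ∀ k, ∀ s ∈ Ioo (Aw k) 0, IsWeaklyDivFree (w k s) := by
    intro k s hs
    have hsI : s ∈ Ioo (Aw k) (Bw k) := ⟨hs.1, hs.2.trans (hBwpos k)⟩
    exact VectorCalculus.IsDivFree.isWeaklyDivFree_holds ((hwcl k).divFree s hsI)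
      (((hwcl k).contDiff_velocity hsI).of_le (by exact_mod_cast le_top))
  have hmild : ∀ k, ∀ s t : ℝ, Aw k < s → s < t → t < 0 → ∀ y,
      w k t y = UnboundedOperators.heatExtension (w k s) (t - s) y - oseenDuhamel 1 s (w k) (w k) t y :=
    fun k s t hs hst ht y =>
      zoom_oseen_window (t₀ := τ k) (x₀ := x k) hν hT hsol hLH hbdd (hlam k) hs hst (ht.trans (hBwpos k)) y
  have hbd : ∀ k, ∀ s ∈ Ioo (Aw k) 0, ∀ y, ‖w k s y‖ ≤ N := by
    intro k s hs y
    have hA := (hn k).2.2.1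
    have hs1 : -(τ k * A k ^ 2 / ν) < s := by rw [← hAw k]; exact hs.1
    -- the physical time lies in `(0, τ_k)`
    have ht1 : 0 < τ k + ν * s / A k ^ 2 := by
      have hA2 : 0 < A k ^ 2 := pow_pos hA 2
      have h1 : -(τ k * A k ^ 2) < ν * s := by
        have := mul_lt_mul_of_pos_left hs1 hν
        have e : ν * -(τ k * A k ^ 2 / ν) = -(τ k * A k ^ 2) := by field_simp
        linarith [e ▸ this]
      have h2 : -(τ k) < ν * s / A k ^ 2 := by
        rw [lt_div_iff₀ hA2]; linarith
      linarith
    have ht2 : τ k + ν * s / A k ^ 2 < τ k := by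
      have : ν * s / A k ^ 2 < 0 := div_neg_of_neg_of_pos (mul_neg_of_pos_of_neg hν hs.2) (pow_pos hA 2)
      linarith
    have hu := (hn k).2.2.2.1 _ ⟨ht1, ht2⟩ (x k + (ν / A k) • y)
    rw [← hZw k s y, norm_smul, norm_inv, Real.norm_of_nonneg hA.le]
    calc (A k)⁻¹ * ‖u (τ k + ν * s / A k ^ 2) (x k + (ν / A k) • y)‖ ≤ (A k)⁻¹ * (N * A k) :=
          mul_le_mul_of_nonneg_left hu (inv_nonneg.2 hA.le)
      _ = N := by field_simp
  -- ### KNSS 2009, Lemma 6.1 (rate-free, bounded Oseen-mild form)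
  obtain ⟨φ, W, hφ, hWc, -, -, hWmild, -, hpt, hslice⟩ :=
    KNSS2009_lemma61_oseenMild (E := EuclideanSpace ℝ (Fin 3)) hAlim hcont hdivw hmild hbd
  have hφt : Tendsto φ atTop atTop := hφ.tendsto_atTop
  refine ⟨W, φ, hφ, ⟨hWc, fun s t hst ht0 y => ?_, fun t ht0 y => ?_⟩, fun t ht0 => ?_⟩
  · rw [heatFlow_of_pos _ (sub_pos.2 hst)]
    exact hWmild s t hst ht0 y
  · -- the Type-I bound passes to the pointwise limit
    have hev : ∀ᶠ k in atTop, Real.sqrt (-t) * ‖w (φ k) t y‖ ≤ K := by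
      filter_upwards [(hAlim.comp hφt).eventually (eventually_lt_atBot t)] with k hk
      have hk' : -(τ (φ k) * A (φ k) ^ 2 / ν) < t := by rw [← hAw (φ k)]; exact hk
      have h := (hn (φ k)).2.2.2.2 t hk' ht0 y
      rwa [hZw (φ k) t y] at h
    have hlim : Tendsto (fun k => Real.sqrt (-t) * ‖w (φ k) t y‖) atTop (𝓝 (Real.sqrt (-t) * ‖W t y‖)) :=
      ((hpt t ht0 y).norm).const_mul _
    exact le_of_tendsto hlim hev
  · have hfun : (fun k => fun y => (A (φ k))⁻¹ • u (τ (φ k) + ν * t / A (φ k) ^ 2) (x (φ k) + (ν / A (φ k)) • y)) =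
        fun k => w (φ k) t := funext fun k => funext fun y => hZw (φ k) t y
    rw [hfun]
    exact hslice t ht0
end Summit.NavierStokesRegularity.NavierStokesRegularity.Theorems.ExtremiserTransience
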